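import Mathlib

/-!
# Crux `ExactCertificate` (stmt-AtomisticToContinuum-11959), line `closure-makes-nogap-exact`,
# skeleton IX (`FarSlackActive`): stub `stub_tailCosTransform` (F6)

Support file for the crux `ThreeConeCertificate.ExactCertificate`, skeleton IX
(`Cruxes.ExactCertificate.FarEqual.FarSlackActive`: the slack cone of an exact three-cone
certificate is active beyond every radius).  That skeleton needs, for `N = 2n + 2` and `ρ > 0`,
that the cosine transform of the power tail

  `K(σ) := ∫_ρ^∞ x^{-N} cos (σ x) dx`

coincides on `σ > 0` with an entire function of exponential type.  Mechanism (no Dirichlet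
integral, no contour shift): write `cos (σ x) = T(σ x) + (cos (σ x) − T(σ x))` with
`T(y) = Σ_{k ≤ n} (−1)^k y^{2k} / (2k)!` the Taylor polynomial of degree `2n`.

* The Taylor part integrates termwise to a POLYNOMIAL in `σ`:
  `∫_ρ^∞ x^{-N} (σ x)^{2k} dx = σ^{2k} ρ^{2k-N+1} / (N-1-2k)` (`integral_Ioi_rpow_of_lt`, the
  exponent `2k - N ≤ -2`), see `taylorPart_integral`.
* The remainder part is `∫_ρ^∞ = ∫_0^∞ − ∫_{(0, ρ]}`; by the scaling hypothesis (stub F5) the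
  full integral is `|σ|^{2n+1} C` with the real constant `C = ∫_0^∞ u^{-N}(cos u − T u) du`, and by
  stub F4 the compact piece `∫_{(0, ρ]}` is the restriction to `ℝ` of an entire function `R` of
  exponential type (its value at a real `σ` is the complex cast of the real integral,
  `integral_complex_ofReal` + `push_cast`), see `tail_identity`.
* Hence `E z := Σ_k b_k z^{2k} + C z^{2n+1} − R z` is entire, satisfies `E σ = K(σ)` for `σ > 0`
  (`|σ| = σ`), and has exponential type: `‖z‖^j ≤ j! e^{‖z‖}` (`Real.pow_div_factorial_le_exp`)
  bounds the polynomial part by `A e^{max τ 1 ‖z‖}`.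

Pure Mathlib; private helper lemmas only, no named facts.  All `[folklore]`.
-/

noncomputable section

namespace Summit.AtomisticToContinuum.Crystallization.Theorems.ThreeConeCertificateExactCertificate.FarEqual

open MeasureTheory Set
open scoped BigOperators

/-- The power tail integral: for `ρ > 0` and `m ≥ 1`, `x ↦ x^{-(m+1)}` is integrable on `(ρ, ∞)`
and `∫_ρ^∞ x^{-(m+1)} dx = ρ^{-m} / m` (via `integral_Ioi_rpow_of_lt` with the real exponent
`-(m+1) < -1`). [folklore] -/
private theorem integral_Ioi_inv_pow_succ {ρ : ℝ} (hρ : 0 < ρ) {m : ℕ} (hm : 0 < m) :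
    IntegrableOn (fun x : ℝ => (x ^ (m + 1))⁻¹) (Set.Ioi ρ) ∧
      ∫ x in Set.Ioi ρ, (x ^ (m + 1))⁻¹ = (ρ ^ m)⁻¹ / (m : ℝ) := by
  have hm' : (0 : ℝ) < m := by exact_mod_cast hm
  have ha : -((m : ℝ) + 1) < -1 := by linarith
  have heq : ∀ x ∈ Set.Ioi ρ, x ^ (-((m : ℝ) + 1)) = (x ^ (m + 1))⁻¹ := by
    intro x hx
    have hx0 : 0 ≤ x := (hρ.trans hx).le
    rw [Real.rpow_neg hx0, ← Nat.cast_succ, Real.rpow_natCast]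
  refine ⟨(integrableOn_Ioi_rpow_of_lt ha hρ).congr_fun heq measurableSet_Ioi, ?_⟩
  rw [← setIntegral_congr_fun measurableSet_Ioi heq, integral_Ioi_rpow_of_lt ha hρ]
  have h1 : -((m : ℝ) + 1) + 1 = -(m : ℝ) := by ring
  rw [h1, Real.rpow_neg hρ.le, Real.rpow_natCast, neg_div_neg_eq]

/-- The Taylor part of the tail integrates termwise to a polynomial in `σ`: for `ρ > 0` there are
real coefficients `b_k` (namely `(−1)^k ρ^{2k-2n-1} / ((2k)! (2n+1-2k))`) with
`x ↦ x^{-(2n+2)} T_n(σ x)` integrable on `(ρ, ∞)` and `∫_ρ^∞ x^{-(2n+2)} T_n(σ x) dx = Σ_k b_k σ^{2k}`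
for every real `σ`. [folklore] -/
private theorem taylorPart_integral {ρ : ℝ} (hρ : 0 < ρ) (n : ℕ) : ∃ b : ℕ → ℝ, ∀ σ : ℝ,
    IntegrableOn (fun x : ℝ => (x ^ (2 * n + 2))⁻¹ *
        ∑ k ∈ Finset.range (n + 1), (-1 : ℝ) ^ k * (σ * x) ^ (2 * k) / ((2 * k).factorial : ℝ))
        (Set.Ioi ρ) ∧
      ∫ x in Set.Ioi ρ, (x ^ (2 * n + 2))⁻¹ *
          ∑ k ∈ Finset.range (n + 1), (-1 : ℝ) ^ k * (σ * x) ^ (2 * k) / ((2 * k).factorial : ℝ) =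
        ∑ k ∈ Finset.range (n + 1), b k * σ ^ (2 * k) := by
  refine ⟨fun k => (-1 : ℝ) ^ k / ((2 * k).factorial : ℝ) *
    ((ρ ^ (2 * n + 1 - 2 * k))⁻¹ / ((2 * n + 1 - 2 * k : ℕ) : ℝ)), fun σ => ?_⟩
  -- termwise normal form on `(ρ, ∞)`
  have hterm : ∀ k ∈ Finset.range (n + 1), ∀ x ∈ Set.Ioi ρ,
      (x ^ (2 * n + 2))⁻¹ * ((-1 : ℝ) ^ k * (σ * x) ^ (2 * k) / ((2 * k).factorial : ℝ)) =
        (-1 : ℝ) ^ k / ((2 * k).factorial : ℝ) * σ ^ (2 * k) * (x ^ ((2 * n + 1 - 2 * k) + 1))⁻¹ := by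
    intro k hk x hx
    have hkn : k ≤ n := Nat.lt_succ_iff.mp (Finset.mem_range.mp hk)
    have hx0 : x ≠ 0 := (hρ.trans hx).ne'
    have hpow : x ^ (2 * n + 2) = x ^ ((2 * n + 1 - 2 * k) + 1) * x ^ (2 * k) := by
      rw [← pow_add]
      congr 1
      omega
    rw [hpow, mul_pow]
    field_simp
  -- each term is integrable on `(ρ, ∞)`
  have hint : ∀ k ∈ Finset.range (n + 1), IntegrableOn (fun x : ℝ =>
      (x ^ (2 * n + 2))⁻¹ * ((-1 : ℝ) ^ k * (σ * x) ^ (2 * k) / ((2 * k).factorial : ℝ)))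
      (Set.Ioi ρ) := by
    intro k hk
    have hm : 0 < 2 * n + 1 - 2 * k := by
      have := Finset.mem_range.mp hk
      omega
    have hI : IntegrableOn (fun x : ℝ => (-1 : ℝ) ^ k / ((2 * k).factorial : ℝ) * σ ^ (2 * k) *
        (x ^ ((2 * n + 1 - 2 * k) + 1))⁻¹) (Set.Ioi ρ) :=
      (integral_Ioi_inv_pow_succ hρ hm).1.const_mul _
    exact hI.congr_fun (fun x hx => (hterm k hk x hx).symm) measurableSet_Ioi
  have hfun : (fun x : ℝ => (x ^ (2 * n + 2))⁻¹ *
      ∑ k ∈ Finset.range (n + 1), (-1 : ℝ) ^ k * (σ * x) ^ (2 * k) / ((2 * k).factorial : ℝ)) =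
      fun x => ∑ k ∈ Finset.range (n + 1),
        (x ^ (2 * n + 2))⁻¹ * ((-1 : ℝ) ^ k * (σ * x) ^ (2 * k) / ((2 * k).factorial : ℝ)) := by
    funext x
    rw [Finset.mul_sum]
  refine ⟨?_, ?_⟩
  · rw [hfun]
    exact integrable_finsetSum _ hint
  · rw [hfun, integral_finsetSum _ hint]
    refine Finset.sum_congr rfl fun k hk => ?_
    have hm : 0 < 2 * n + 1 - 2 * k := by
      have := Finset.mem_range.mp hk
      omega
    rw [setIntegral_congr_fun measurableSet_Ioi (hterm k hk), integral_const_mul,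
      (integral_Ioi_inv_pow_succ hρ hm).2]
    ring

/-- The real tail identity: if the remainder `x ↦ x^{-(2n+2)}(cos (σ x) − T_n(σ x))` is integrable
on `(0, ∞)` with integral `|σ|^{2n+1} C`, and the Taylor part is integrable on `(ρ, ∞)` with
integral `P`, then for `σ > 0`
`∫_ρ^∞ x^{-(2n+2)} cos (σ x) dx = P + C σ^{2n+1} − ∫_{(0, ρ]} x^{-(2n+2)}(cos (σ x) − T_n(σ x)) dx`
(split `(0, ∞) = (0, ρ] ∪ (ρ, ∞)` and add the two integrable pieces on `(ρ, ∞)`). [folklore] -/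
private theorem tail_identity {n : ℕ} {ρ σ C P : ℝ} (hρ : 0 < ρ) (hσ : 0 < σ)
    (hint : IntegrableOn (fun x : ℝ => (x ^ (2 * n + 2))⁻¹ * (Real.cos (σ * x) -
      ∑ k ∈ Finset.range (n + 1), (-1 : ℝ) ^ k * (σ * x) ^ (2 * k) / ((2 * k).factorial : ℝ)))
      (Set.Ioi 0))
    (hscale : ∫ x in Set.Ioi 0, (x ^ (2 * n + 2))⁻¹ * (Real.cos (σ * x) -
      ∑ k ∈ Finset.range (n + 1), (-1 : ℝ) ^ k * (σ * x) ^ (2 * k) / ((2 * k).factorial : ℝ)) =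
        |σ| ^ (2 * n + 1) * C)
    (hTint : IntegrableOn (fun x : ℝ => (x ^ (2 * n + 2))⁻¹ *
      ∑ k ∈ Finset.range (n + 1), (-1 : ℝ) ^ k * (σ * x) ^ (2 * k) / ((2 * k).factorial : ℝ))
      (Set.Ioi ρ))
    (hTval : ∫ x in Set.Ioi ρ, (x ^ (2 * n + 2))⁻¹ *
      ∑ k ∈ Finset.range (n + 1), (-1 : ℝ) ^ k * (σ * x) ^ (2 * k) / ((2 * k).factorial : ℝ) = P) :
    ∫ x in Set.Ioi ρ, (x ^ (2 * n + 2))⁻¹ * Real.cos (σ * x) =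
      P + C * σ ^ (2 * n + 1) - ∫ x in Set.Ioc 0 ρ, (x ^ (2 * n + 2))⁻¹ * (Real.cos (σ * x) -
        ∑ k ∈ Finset.range (n + 1), (-1 : ℝ) ^ k * (σ * x) ^ (2 * k) / ((2 * k).factorial : ℝ)) := by
  set rem : ℝ → ℝ := fun x => (x ^ (2 * n + 2))⁻¹ * (Real.cos (σ * x) -
      ∑ k ∈ Finset.range (n + 1), (-1 : ℝ) ^ k * (σ * x) ^ (2 * k) / ((2 * k).factorial : ℝ))
    with hrem
  have hIoc : IntegrableOn rem (Set.Ioc 0 ρ) := hint.mono_set Set.Ioc_subset_Ioi_self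
  have hIoi : IntegrableOn rem (Set.Ioi ρ) := hint.mono_set (Set.Ioi_subset_Ioi hρ.le)
  have hsplit : (∫ x in Set.Ioc 0 ρ, rem x) + ∫ x in Set.Ioi ρ, rem x = |σ| ^ (2 * n + 1) * C := by
    rw [← setIntegral_union Set.Ioc_disjoint_Ioi_same measurableSet_Ioi hIoc hIoi,
      Set.Ioc_union_Ioi_eq_Ioi hρ.le]
    exact hscale
  have hadd : ∫ x in Set.Ioi ρ, (x ^ (2 * n + 2))⁻¹ * Real.cos (σ * x) =
      P + ∫ x in Set.Ioi ρ, rem x := by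
    rw [← hTval, ← integral_add hTint hIoi]
    refine setIntegral_congr_fun measurableSet_Ioi fun x _ => ?_
    simp only [hrem]
    ring
  rw [abs_of_pos hσ] at hsplit
  linear_combination hadd + hsplit

/-- Monomials have exponential type: `‖z‖^j ≤ j! e^{τ ‖z‖}` for `τ ≥ 1`
(`Real.pow_div_factorial_le_exp`). [folklore] -/
private theorem norm_pow_le_factorial_mul_exp (z : ℂ) (j : ℕ) {τ : ℝ} (hτ : 1 ≤ τ) :
    ‖z‖ ^ j ≤ (j.factorial : ℝ) * Real.exp (τ * ‖z‖) := by
  have h1 : ‖z‖ ^ j / (j.factorial : ℝ) ≤ Real.exp ‖z‖ :=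
    Real.pow_div_factorial_le_exp ‖z‖ (norm_nonneg z) j
  have h2 : Real.exp ‖z‖ ≤ Real.exp (τ * ‖z‖) :=
    Real.exp_le_exp.2 (by nlinarith [norm_nonneg z])
  have hj : (0 : ℝ) < j.factorial := by exact_mod_cast j.factorial_pos
  rw [div_le_iff₀ hj] at h1
  calc ‖z‖ ^ j ≤ Real.exp ‖z‖ * j.factorial := h1
    _ ≤ Real.exp (τ * ‖z‖) * j.factorial := by gcongr
    _ = (j.factorial : ℝ) * Real.exp (τ * ‖z‖) := mul_comm _ _

/-- Stub F6 (cosine transform of the power tail is entire on `σ > 0`): given F4 (the compact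
remainder piece `σ ↦ ∫_{(0, ρ]} x^{-(2n+2)}(cos (σ x) − T_n(σ x)) dx` is the restriction of an
entire function of exponential type) and F5 (the full remainder integral scales as
`|σ|^{2n+1} C`), for every `n` and `ρ > 0` there is an entire `E` of exponential type with
`E σ = ∫_ρ^∞ x^{-(2n+2)} cos (σ x) dx` for all `σ > 0`; explicitly
`E z = Σ_{k ≤ n} b_k z^{2k} + C z^{2n+1} − R z`. [folklore] -/
theorem stub_tailCosTransform : (∀ (n : ℕ) (ρ : ℝ), 0 < ρ → ∃ R : ℂ → ℂ, Differentiable ℂ R ∧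
        (∃ B τ : ℝ, ∀ z : ℂ, ‖R z‖ ≤ B * Real.exp (τ * ‖z‖)) ∧
        ∀ σ : ℝ, R (σ : ℂ) = ∫ x in Set.Ioc 0 ρ,
          (((x ^ (2 * n + 2))⁻¹ : ℝ) : ℂ) * (Complex.cos ((σ : ℂ) * x) - ∑ k ∈ Finset.range (n + 1), (-1 : ℂ) ^ k * ((σ : ℂ) * x) ^ (2 * k) / ((2 * k).factorial : ℂ))) →
    (∀ n : ℕ, MeasureTheory.IntegrableOn (fun u : ℝ => (u ^ (2 * n + 2))⁻¹ * (Real.cos u - ∑ k ∈ Finset.range (n + 1), (-1 : ℝ) ^ k * u ^ (2 * k) / ((2 * k).factorial : ℝ))) (Set.Ioi 0) ∧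
        ∀ σ : ℝ, σ ≠ 0 → MeasureTheory.IntegrableOn (fun x : ℝ => (x ^ (2 * n + 2))⁻¹ * (Real.cos (σ * x) - ∑ k ∈ Finset.range (n + 1), (-1 : ℝ) ^ k * (σ * x) ^ (2 * k) / ((2 * k).factorial : ℝ))) (Set.Ioi 0) ∧
          ∫ x in Set.Ioi 0, (x ^ (2 * n + 2))⁻¹ * (Real.cos (σ * x) - ∑ k ∈ Finset.range (n + 1), (-1 : ℝ) ^ k * (σ * x) ^ (2 * k) / ((2 * k).factorial : ℝ)) =
            |σ| ^ (2 * n + 1) * ∫ u in Set.Ioi 0, (u ^ (2 * n + 2))⁻¹ * (Real.cos u - ∑ k ∈ Finset.range (n + 1), (-1 : ℝ) ^ k * u ^ (2 * k) / ((2 * k).factorial : ℝ))) →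
    ∀ (n : ℕ) (ρ : ℝ), 0 < ρ → ∃ E : ℂ → ℂ, Differentiable ℂ E ∧
        (∃ B τ : ℝ, ∀ z : ℂ, ‖E z‖ ≤ B * Real.exp (τ * ‖z‖)) ∧
        ∀ σ : ℝ, 0 < σ → E (σ : ℂ) = ((∫ x in Set.Ioi ρ, (x ^ (2 * n + 2))⁻¹ * Real.cos (σ * x) : ℝ) : ℂ) := by
  intro hF4 hF5 n ρ hρ
  obtain ⟨R, hRd, ⟨B, τ, hRb⟩, hRσ⟩ := hF4 n ρ hρ
  -- the real constant `C = ∫_0^∞ u^{-(2n+2)}(cos u − T_n u) du`, abstracted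
  obtain ⟨C, hC⟩ : ∃ C : ℝ, ∀ σ : ℝ, σ ≠ 0 →
      IntegrableOn (fun x : ℝ => (x ^ (2 * n + 2))⁻¹ * (Real.cos (σ * x) -
        ∑ k ∈ Finset.range (n + 1), (-1 : ℝ) ^ k * (σ * x) ^ (2 * k) / ((2 * k).factorial : ℝ)))
        (Set.Ioi 0) ∧
      ∫ x in Set.Ioi 0, (x ^ (2 * n + 2))⁻¹ * (Real.cos (σ * x) -
        ∑ k ∈ Finset.range (n + 1), (-1 : ℝ) ^ k * (σ * x) ^ (2 * k) / ((2 * k).factorial : ℝ)) =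
          |σ| ^ (2 * n + 1) * C :=
    ⟨_, (hF5 n).2⟩
  -- the polynomial coefficients of the Taylor part, abstracted
  obtain ⟨b, hb⟩ := taylorPart_integral hρ n
  refine ⟨fun z => (∑ k ∈ Finset.range (n + 1), (b k : ℂ) * z ^ (2 * k)) +
    (C : ℂ) * z ^ (2 * n + 1) - R z, ?_, ?_, ?_⟩
  · -- entire: polynomials and `R`
    fun_prop
  · -- exponential type
    refine ⟨(∑ k ∈ Finset.range (n + 1), |b k| * ((2 * k).factorial : ℝ)) +
      |C| * ((2 * n + 1).factorial : ℝ) + |B|, max τ 1, fun z => ?_⟩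
    have hτ' : 1 ≤ max τ 1 := le_max_right _ _
    have hexp : Real.exp (τ * ‖z‖) ≤ Real.exp (max τ 1 * ‖z‖) :=
      Real.exp_le_exp.2 (mul_le_mul_of_nonneg_right (le_max_left _ _) (norm_nonneg _))
    have hpow := fun j => norm_pow_le_factorial_mul_exp z j hτ'
    have h1 : ‖∑ k ∈ Finset.range (n + 1), (b k : ℂ) * z ^ (2 * k)‖ ≤
        (∑ k ∈ Finset.range (n + 1), |b k| * ((2 * k).factorial : ℝ)) *
          Real.exp (max τ 1 * ‖z‖) := by
      rw [Finset.sum_mul]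
      refine (norm_sum_le _ _).trans (Finset.sum_le_sum fun k _ => ?_)
      rw [norm_mul, norm_pow, Complex.norm_real, Real.norm_eq_abs, mul_assoc]
      exact mul_le_mul_of_nonneg_left (hpow (2 * k)) (abs_nonneg _)
    have h2 : ‖(C : ℂ) * z ^ (2 * n + 1)‖ ≤
        |C| * ((2 * n + 1).factorial : ℝ) * Real.exp (max τ 1 * ‖z‖) := by
      rw [norm_mul, norm_pow, Complex.norm_real, Real.norm_eq_abs, mul_assoc]
      exact mul_le_mul_of_nonneg_left (hpow (2 * n + 1)) (abs_nonneg _)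
    have h3 : ‖R z‖ ≤ |B| * Real.exp (max τ 1 * ‖z‖) :=
      (hRb z).trans ((mul_le_mul_of_nonneg_right (le_abs_self B) (Real.exp_pos _).le).trans
        (mul_le_mul_of_nonneg_left hexp (abs_nonneg B)))
    calc ‖(∑ k ∈ Finset.range (n + 1), (b k : ℂ) * z ^ (2 * k)) + (C : ℂ) * z ^ (2 * n + 1) - R z‖
        ≤ ‖(∑ k ∈ Finset.range (n + 1), (b k : ℂ) * z ^ (2 * k)) + (C : ℂ) * z ^ (2 * n + 1)‖ +
            ‖R z‖ := norm_sub_le _ _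
      _ ≤ ‖∑ k ∈ Finset.range (n + 1), (b k : ℂ) * z ^ (2 * k)‖ + ‖(C : ℂ) * z ^ (2 * n + 1)‖ +
            ‖R z‖ := by
          gcongr
          exact norm_add_le _ _
      _ ≤ (∑ k ∈ Finset.range (n + 1), |b k| * ((2 * k).factorial : ℝ)) *
              Real.exp (max τ 1 * ‖z‖) +
            |C| * ((2 * n + 1).factorial : ℝ) * Real.exp (max τ 1 * ‖z‖) +
            |B| * Real.exp (max τ 1 * ‖z‖) := add_le_add (add_le_add h1 h2) h3
      _ = ((∑ k ∈ Finset.range (n + 1), |b k| * ((2 * k).factorial : ℝ)) +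
            |C| * ((2 * n + 1).factorial : ℝ) + |B|) * Real.exp (max τ 1 * ‖z‖) := by ring
  · -- the value at real `σ > 0`
    intro σ hσ
    obtain ⟨hint, hscale⟩ := hC σ hσ.ne'
    obtain ⟨hTint, hTval⟩ := hb σ
    have hRreal : R (σ : ℂ) = ((∫ x in Set.Ioc 0 ρ, (x ^ (2 * n + 2))⁻¹ * (Real.cos (σ * x) -
        ∑ k ∈ Finset.range (n + 1), (-1 : ℝ) ^ k * (σ * x) ^ (2 * k) / ((2 * k).factorial : ℝ))
          : ℝ) : ℂ) := by
      rw [hRσ σ, ← integral_complex_ofReal]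
      congr 1
      funext x
      push_cast
      ring
    beta_reduce
    rw [tail_identity hρ hσ hint hscale hTint hTval, hRreal]
    push_cast
    ring

end Summit.AtomisticToContinuum.Crystallization.Theorems.ThreeConeCertificateExactCertificate.FarEqual
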